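import Summits.QuantumFields.BalabanUV.Beta.GAN24.LayerSeamLettersFubini

/-!
# (R-iv) seam letters, PART 3a — the COUNT socket over blocks

G-an2-4 / CT-W, (LT) «LAYER TRANSPORT» row, key K-LL-4.  PART 2 (`LayerSeamLettersFubini`) wrote the
(b3) seam cell of a block-constant table gauge as `Σ'_B Λ_{νU} B · P_B` with
`P_B(x′,z′) = Σ'_z Σ'_x G(x,z)·(𝟙_B z − 𝟙_B x)` the two-leg pairing against the block-indicator
commutator `[S₀, 𝟙_B]`.  This file is the socket through which a per-block bound is cashed:

* `abs_push₃_blockGauge_le_of_blocks`: DISPLAYED `|P_B(x′,z′)| ≤ w B` for every block label and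
  `Summable (|Λ_{νU} ·|·w)` ⊢ `|cell| ≤ Σ'_B |Λ_{νU} B|·w B`;
* `abs_push₃_blockGauge_le_of_blocks_biLoc`: the same with a bi-localised per-block bound
  `|P_B(x′,z′)| ≤ w B·e^{−δ′(‖x′−U₀‖₁+‖z′−U₀‖₁)}` and a seam budget `Σ'_B |Λ_{νU} B|·w B ≤ J`
  ⊢ `|cell(x′,z′)| ≤ J·e^{−δ′(‖x′−U₀‖₁+‖z′−U₀‖₁)}` — the `BiLoc` currency of the END's `hLT` on the
  ff block.

[folklore] `tsum_of_norm_bounded`; no estimate of the per-block pushes is made here (that is where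
the moment gain at the seams — (M0) of `[S₀, 𝟙_B]` one level up, KLL4-CELLS v0.2 §6 — is to be
proved); nothing of (Q-R)/(LT)/(S) is discharged.
-/

noncomputable section

open Finset
open scoped BigOperators
open Literature.MathematicalPhysics.QuantumFieldTheory
open Literature.MathematicalPhysics.QuantumFieldTheory.Balaban1983to89
open Literature.MathematicalPhysics.QuantumFieldTheory.Balaban1983to89.Beta
open ExpKernelCalculus (MKer Site)
open AveragingContours (blk)
open AffineAveraging (dz)
open OneStepResolventKernel (Fib)
open Summit.QuantumFields.BalabanUV.Beta.GAN24.Push3 (push₃)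
open Summit.QuantumFields.BalabanUV.Beta.GAN24.LayerSeamLettersFubini (push₃_blockGauge_eq_tsum_blocks)

namespace Summit.QuantumFields.BalabanUV.Beta.GAN24.LayerSeamLettersCount

variable {d : ℕ}

variable {l r : Fin (d + 1) → (Fin (d + 1) → ℤ) → Fin (d + 1) → (Fin (d + 1) → ℤ) → ℝ}
  {S : Fin (d + 1) → (Fin (d + 1) → ℤ) → MKer (d + 1) (Fib d)} {S₀ : MKer (d + 1) (Fib d)}
  (hWard : ∀ (ψ : (Fin (d + 1) → ℤ) → ℝ) (x z : Fin (d + 1) → ℤ) (κ₁ κ₂ : Fin (d + 1)),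
    ∑ κ : Fin (d + 1), ∑' u : Fin (d + 1) → ℤ, dz ψ κ u * S κ u x z (Sum.inl κ₁) (Sum.inl κ₂)
      = S₀ x z (Sum.inl κ₁) (Sum.inl κ₂) * (ψ z - ψ x))
  (M : ℕ) (Λ : Fin (d + 1) → (Fin (d + 1) → ℤ) → Site (d + 1) → ℝ)

include hWard in
open Classical in
/-- NOT IN PRINT; OUR BOOKKEEPING.  **THE COUNT SOCKET OVER BLOCKS**: a DISPLAYED bound `w B` on the two-leg pairing against each
block-indicator commutator, summable against the seam values, bounds the (b3) seam cell by the seam budget `Σ'_B |Λ_{νU} B|·w B`. -/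
theorem abs_push₃_blockGauge_le_of_blocks {C₀ Cr m Λbar : ℝ} (hls : ∀ α x' κ, Summable fun x => l α x' κ x) (hm : 0 < m)
    (hS₀ : ∀ x z a b, |S₀ x z a b| ≤ C₀ * Real.exp (-m * B12Sec2to5.l1 (x - z))) (hr : ∀ β z' κ z, |r β z' κ z| ≤ Cr)
    (hΛ : ∀ ν U B, |Λ ν U B| ≤ Λbar) (ν : Fin (d + 1)) (U x' z' : Fin (d + 1) → ℤ) (α β : Fin (d + 1))
    {w : Site (d + 1) → ℝ}
    (hP : ∀ B : Site (d + 1), |∑' z : Site (d + 1), ∑' x : Site (d + 1),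
        (∑ κ₂ : Fin (d + 1), ∑ κ₁ : Fin (d + 1), l α x' κ₁ x * S₀ x z (Sum.inl κ₁) (Sum.inl κ₂) * r β z' κ₂ z)
          * ((if blk M z = B then (1 : ℝ) else 0) - (if blk M x = B then (1 : ℝ) else 0))| ≤ w B)
    (hw : Summable fun B => |Λ ν U B| * w B) :
    |push₃ l r (fun ν U κ u => dz (fun y => Λ ν U (blk M y)) κ u) S ν U x' z' (Sum.inl α) (Sum.inl β)|
      ≤ ∑' B : Site (d + 1), |Λ ν U B| * w B := by
  rw [push₃_blockGauge_eq_tsum_blocks hWard M Λ hls hm hS₀ hr hΛ ν U x' z' α β, ← Real.norm_eq_abs]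
  refine tsum_of_norm_bounded hw.hasSum fun B => ?_
  rw [Real.norm_eq_abs, abs_mul]
  exact mul_le_mul_of_nonneg_left (hP B) (abs_nonneg _)

include hWard in
open Classical in
/-- NOT IN PRINT; OUR BOOKKEEPING.  **THE COUNT SOCKET IN `BiLoc` CURRENCY**: per-block bounds bi-localised at `U₀` with block weights `w B`
and a seam budget `Σ'_B |Λ_{νU} B|·w B ≤ J` give the (b3) seam cell's ff entry the bound `J·e^{−δ′(‖x′−U₀‖₁+‖z′−U₀‖₁)}`. -/
theorem abs_push₃_blockGauge_le_of_blocks_biLoc {C₀ Cr m Λbar : ℝ} (hls : ∀ α x' κ, Summable fun x => l α x' κ x) (hm : 0 < m)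
    (hS₀ : ∀ x z a b, |S₀ x z a b| ≤ C₀ * Real.exp (-m * B12Sec2to5.l1 (x - z))) (hr : ∀ β z' κ z, |r β z' κ z| ≤ Cr)
    (hΛ : ∀ ν U B, |Λ ν U B| ≤ Λbar) (ν : Fin (d + 1)) (U U₀ : Fin (d + 1) → ℤ) {w : Site (d + 1) → ℝ} {δ' J : ℝ}
    (hP : ∀ (B : Site (d + 1)) (x' z' : Fin (d + 1) → ℤ) (α β : Fin (d + 1)), |∑' z : Site (d + 1), ∑' x : Site (d + 1),
        (∑ κ₂ : Fin (d + 1), ∑ κ₁ : Fin (d + 1), l α x' κ₁ x * S₀ x z (Sum.inl κ₁) (Sum.inl κ₂) * r β z' κ₂ z)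
          * ((if blk M z = B then (1 : ℝ) else 0) - (if blk M x = B then (1 : ℝ) else 0))|
        ≤ w B * Real.exp (-δ' * (B12Sec2to5.l1 (x' - U₀) + B12Sec2to5.l1 (z' - U₀))))
    (hw : Summable fun B => |Λ ν U B| * w B) (hJ : ∑' B : Site (d + 1), |Λ ν U B| * w B ≤ J)
    (x' z' : Fin (d + 1) → ℤ) (α β : Fin (d + 1)) :
    |push₃ l r (fun ν U κ u => dz (fun y => Λ ν U (blk M y)) κ u) S ν U x' z' (Sum.inl α) (Sum.inl β)|
      ≤ J * Real.exp (-δ' * (B12Sec2to5.l1 (x' - U₀) + B12Sec2to5.l1 (z' - U₀))) := by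
  have h := abs_push₃_blockGauge_le_of_blocks hWard M Λ hls hm hS₀ hr hΛ ν U x' z' α β
    (w := fun B => w B * Real.exp (-δ' * (B12Sec2to5.l1 (x' - U₀) + B12Sec2to5.l1 (z' - U₀))))
    (fun B => hP B x' z' α β) ((hw.mul_right _).congr fun B => by ring)
  refine h.trans ?_
  rw [show (fun B => |Λ ν U B| * (w B * Real.exp (-δ' * (B12Sec2to5.l1 (x' - U₀) + B12Sec2to5.l1 (z' - U₀)))))
      = fun B => (|Λ ν U B| * w B) * Real.exp (-δ' * (B12Sec2to5.l1 (x' - U₀) + B12Sec2to5.l1 (z' - U₀))) from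
      funext fun B => by ring, tsum_mul_right]
  exact mul_le_mul_of_nonneg_right hJ (Real.exp_nonneg _)

end Summit.QuantumFields.BalabanUV.Beta.GAN24.LayerSeamLettersCount

end
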